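import Literature.NumberTheory.EllipticCurves.ModularParamYFunction
import Literature.NumberTheory.EllipticCurves.ModularParamXRationality
import HarnessLib

/-!
# `y = ℘_Λ'(2πi∫f)` has a `q`-expansion fixed by `Aut(ℂ/ℚ(g₂, g₃))`

Topic `NumberTheory/EllipticCurves` (complement to `ModularParamXRationality`).  With the notation
there (`a, b, e` the `q`-expansions of `F, G, f`, `θ = q d/dq`), the element
`y = bracket(F, G)/(G²f) ∈ K_N` of `ModularParamYFunction` has Laurent `q`-series
`(bθa − aθb)/(b²e)` (`qExpansion_bracketCusp`: the `q`-expansion of `d/dz F` is `2πi·θa`).  Since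
`σ(a)·b = σ(b)·a` (`map_qExpansion_mul_eq`), the Wronskian `bθa − aθb` scales with the square of
the common factor (`wronskian_mul_sq_eq`), and so **`σ` fixes the `q`-series of `y`**
(`mapLaurent_yFn`).

Everything is proved; no named facts are introduced.

## References

* G. Shimura, *Introduction to the arithmetic theory of automorphic functions*, 1971, §6.2, Thm. 7.14.
  [ShimuraIATAF1971]
-/

noncomputable section

open Complex Filter Topology Set Function PowerSeries
open UpperHalfPlane hiding I
open scoped Real Topology Manifold MatrixGroups PeriodPair ModularForm
open ModularForm CongruenceSubgroup

open Literature.NumberTheory.EllipticCurves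

namespace Literature.NumberTheory.EllipticCurves.ModularForms

variable {N : ℕ} [NeZero N] {k : ℤ}

/-- **The `q`-expansion of the bracket** `(2πi)⁻¹(G·F′ − F·G′)` is `bθa − aθb`. [folklore] -/
theorem qExpansion_bracketCusp (F G : CuspForm (Gamma0 N) k) :
    qExpansion 1 (⇑(bracketCusp F G)) =
      qExpansion 1 (⇑G) * thetaPS (qExpansion 1 (⇑F)) - qExpansion 1 (⇑F) * thetaPS (qExpansion 1 (⇑G)) := by
  have hF := isCuspFunction_one F
  have hG := isCuspFunction_one G
  set a := qExpansion 1 (⇑F) with ha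
  set b := qExpansion 1 (⇑G) with hb
  obtain ⟨hdF, edF⟩ := qexp_track_deriv hF ha.symm
  obtain ⟨hdG, edG⟩ := qexp_track_deriv hG hb.symm
  obtain ⟨h1, e1⟩ := qexp_track_mul hG hb.symm hdF edF
  obtain ⟨h2, e2⟩ := qexp_track_mul hF ha.symm hdG edG
  obtain ⟨hW, eW⟩ := qexp_track_sub h1 e1 h2 e2
  obtain ⟨-, eB⟩ := qexp_track_smul hW eW ((2 * π * I)⁻¹ : ℂ)
  have hfun : (⇑(bracketCusp F G) : ℍ → ℂ) =
      ((2 * π * I)⁻¹ : ℂ) • (⇑G * (fun τ : ℍ ↦ deriv (⇑F ∘ ofComplex) τ) -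
        ⇑F * (fun τ : ℍ ↦ deriv (⇑G ∘ ofComplex) τ)) := by
    funext τ
    rw [bracketCusp_apply]
    simp [smul_eq_mul]
  rw [hfun, eB, thetaPS_def, thetaPS_def]
  have hπ : (2 * π * I : ℂ) ≠ 0 :=
    mul_ne_zero (mul_ne_zero two_ne_zero (ofReal_ne_zero.mpr Real.pi_ne_zero)) I_ne_zero
  have hC : PowerSeries.C ((2 * π * I)⁻¹ : ℂ) * PowerSeries.C (2 * π * I : ℂ) = 1 := by
    rw [← map_mul, inv_mul_cancel₀ hπ, map_one]
  linear_combination (b * PowerSeries.mk (fun n ↦ (n : ℂ) * coeff n a) -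
    a * PowerSeries.mk (fun n ↦ (n : ℂ) * coeff n b)) * hC

namespace IsXPresentation

variable {f : CuspForm (Gamma0 N) 2} {L : PeriodPair} {F G : CuspForm (Gamma0 N) k}

/-- The Laurent `q`-series of `y`: `(bθa − aθb)/(b·b·e)`. [folklore] -/
theorem coe_yFn (h : IsXPresentation f L F G) (hf : f ≠ 0) :
    ((h.yFn hf : modularFunctionField N) : LaurentSeries ℂ) =
      ((qExpansion 1 (⇑G) * thetaPS (qExpansion 1 (⇑F)) - qExpansion 1 (⇑F) * thetaPS (qExpansion 1 (⇑G)) : ℂ⟦X⟧) :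
          LaurentSeries ℂ) /
        ((qExpansion 1 (⇑G) * qExpansion 1 (⇑G) * qExpansion 1 (⇑f) : ℂ⟦X⟧) : LaurentSeries ℂ) := by
  have h1 : qExpansionL N (bracketCusp F G : ModularForm (Gamma0 N) (k + (k + 2))) =
      ((qExpansion 1 (⇑(bracketCusp F G)) : ℂ⟦X⟧) : LaurentSeries ℂ) := rfl
  have hG : qExpansionL N (G : ModularForm (Gamma0 N) k) = ((qExpansion 1 (⇑G) : ℂ⟦X⟧) : LaurentSeries ℂ) := rfl
  have hf2 : qExpansionL N (f : ModularForm (Gamma0 N) 2) = ((qExpansion 1 (⇑f) : ℂ⟦X⟧) : LaurentSeries ℂ) := rfl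
  have h2 : qExpansionL N h.yDen =
      ((qExpansion 1 (⇑G) * qExpansion 1 (⇑G) * qExpansion 1 (⇑f) : ℂ⟦X⟧) : LaurentSeries ℂ) := by
    rw [yDen, qExpansionL_mul, qExpansionL_mul, hG, hf2, PowerSeries.coe_mul, PowerSeries.coe_mul, mul_assoc]
  have h0 : ((h.yFn hf : modularFunctionField N) : LaurentSeries ℂ) =
      qExpansionL N (bracketCusp F G : ModularForm (Gamma0 N) (k + (k + 2))) / qExpansionL N h.yDen := rfl
  rw [h0, h1, h2, qExpansion_bracketCusp]

/-- **`σ` fixes the Laurent `q`-series of `y`.** [cite: ShimuraIATAF1971, Thm. 7.14] -/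
theorem mapLaurent_yFn (h : IsXPresentation f L F G) (hf : f ≠ 0)
    (hrat : ∀ n, ∃ q : ℚ, (q : ℂ) = cuspCoeff f n) (σ : ℂ ≃+* ℂ)
    (hg₂ : σ L.g₂ = L.g₂) (hg₃ : σ L.g₃ = L.g₃) :
    mapLaurent (σ : ℂ →+* ℂ) ((h.yFn hf : modularFunctionField N) : LaurentSeries ℂ) = h.yFn hf := by
  have hb0 : qExpansion 1 (⇑G) ≠ 0 := qExpansion_ne_zero_of_ne_zero h.modularForm_ne_zero
  have hf' : (f : ModularForm (Gamma0 N) 2) ≠ 0 := by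
    intro h0; apply hf; apply DFunLike.ext; intro τ; exact DFunLike.congr_fun h0 τ
  have he0 : qExpansion 1 (⇑f) ≠ 0 := qExpansion_ne_zero_of_ne_zero hf'
  -- `σa * b = σb * a`
  have hR := h.map_qExpansion_mul_eq hf hrat σ hg₂ hg₃
  have hσb0 : (qExpansion 1 (⇑G)).map (σ : ℂ →+* ℂ) ≠ 0 := fun h0 ↦ hb0 (by
    have := congrArg (PowerSeries.map (σ.symm : ℂ →+* ℂ)) h0
    rwa [map_symm_map, map_zero] at this)
  -- the Wronskian scales with the square of the common factor
  have hW := wronskian_mul_sq_eq (A := qExpansion 1 (⇑F)) (B := qExpansion 1 (⇑G))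
    (a := (qExpansion 1 (⇑F)).map (σ : ℂ →+* ℂ)) (b := (qExpansion 1 (⇑G)).map (σ : ℂ →+* ℂ)) hb0 hR
  have heσ : (qExpansion 1 (⇑f)).map (σ : ℂ →+* ℂ) = qExpansion 1 (⇑f) :=
    qExpansion_map_eq_self_of_rat f hrat (σ := σ)
  have hNum : (qExpansion 1 (⇑G) * thetaPS (qExpansion 1 (⇑F)) - qExpansion 1 (⇑F) * thetaPS (qExpansion 1 (⇑G))).map
      (σ : ℂ →+* ℂ) = (qExpansion 1 (⇑G)).map (σ : ℂ →+* ℂ) * thetaPS ((qExpansion 1 (⇑F)).map (σ : ℂ →+* ℂ)) -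
        (qExpansion 1 (⇑F)).map (σ : ℂ →+* ℂ) * thetaPS ((qExpansion 1 (⇑G)).map (σ : ℂ →+* ℂ)) := by
    rw [map_sub, map_mul, map_mul, map_thetaPS', map_thetaPS']
  have hDen : (qExpansion 1 (⇑G) * qExpansion 1 (⇑G) * qExpansion 1 (⇑f)).map (σ : ℂ →+* ℂ) =
      (qExpansion 1 (⇑G)).map (σ : ℂ →+* ℂ) * (qExpansion 1 (⇑G)).map (σ : ℂ →+* ℂ) * qExpansion 1 (⇑f) := by
    rw [map_mul, map_mul, heσ]
  have hden : ((qExpansion 1 (⇑G) * qExpansion 1 (⇑G) * qExpansion 1 (⇑f) : ℂ⟦X⟧) : LaurentSeries ℂ) ≠ 0 :=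
    fun h0 ↦ (mul_ne_zero (mul_ne_zero hb0 hb0) he0)
      (HahnSeries.ofPowerSeries_injective (Γ := ℤ) (R := ℂ) (h0.trans (map_zero _).symm))
  have hdenσ : (((qExpansion 1 (⇑G)).map (σ : ℂ →+* ℂ) * (qExpansion 1 (⇑G)).map (σ : ℂ →+* ℂ) *
      qExpansion 1 (⇑f) : ℂ⟦X⟧) : LaurentSeries ℂ) ≠ 0 :=
    fun h0 ↦ (mul_ne_zero (mul_ne_zero hσb0 hσb0) he0)
      (HahnSeries.ofPowerSeries_injective (Γ := ℤ) (R := ℂ) (h0.trans (map_zero _).symm))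
  rw [coe_yFn, map_div₀, mapLaurent_coe_powerSeries, mapLaurent_coe_powerSeries, hNum, hDen,
    div_eq_div_iff hdenσ hden, ← PowerSeries.coe_mul, ← PowerSeries.coe_mul]
  congr 1
  linear_combination qExpansion 1 (⇑f) * hW

end IsXPresentation

end Literature.NumberTheory.EllipticCurves.ModularForms

end
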